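import Literature.NumberTheory.EllipticCurves.Hsieh2014.AnticyclotomicMuInvariant
import Literature.NumberTheory.EllipticCurves.BDPAnticyclotomicPAdicLFunctionSigmaInt
import Literature.NumberTheory.EllipticCurves.UnrIntegersUnits
import HarnessLib

/-!
# Hsieh 2014, Theorem B (= Thm. 2 of the e-print = Thm. 6.2 in the body) IN WEIGHT `k`: the vanishing of the
# anticyclotomic `μ`-invariant of `𝒫_Σ(π_g, λ)` for a newform `g ∈ S_k(Γ₀(M))` of EVEN weight `k ≥ 2` and level
# prime to `p` — Hsieh's weight-`k` display `hsiehInterpolationValueWt`, the frame `IsHsiehLFunctionWt` (weight-`k`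
# twin of `IsHsiehLFunction`, reducing to it at `k = 2`), ONE named fact, and the PROVED bridge to the tree's
# weight-`k` BDP frame `IsBDPLFunctionWtSigmaInt … ∅ …` (Castella's normalisation) carrying the `μ = 0` clause

Topic `NumberTheory/EllipticCurves`, sub-directory `Hsieh2014`. Companion of `Hsieh2014/AnticyclotomicMuInvariant.lean`
(Thm. B at weight `2`, `π = π_{f_E}`; fact `thmB_exists_isHsiehLFunction_coeff_norm_eq_one`) and
`Hsieh2014/AnticyclotomicMuInvariantAnyLevel.lean` (`…_unrPeriod_anyLevel`), whose frame `IsHsiehLFunction`,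
receptacle `PowerSeries (PadicComplexInt p) = 𝒪_{ℂ_p}⟦T⟧`, binders and dictionary ((S1)–(S8), (W1)–(W4), (E1)–(E2),
erratum E-G131-1 of `AnticyclotomicRankinSelbergPAdicLFunction.lean`) are used VERBATIM and not restated; and of
`BDPAnticyclotomicPAdicLFunctionHigherWeight.lean` / `…SigmaInt.lean` (the weight-`k` frames `IsBDPLFunctionWt`,
`IsBDPLFunctionWtSigmaInt` in Castella's normalisation, Castella–Hsieh 2018 Prop. 3.8 at weight `2r = k`). Cell
`pub/bsd-wall`, literature-typer seat `bsd-wall-utd-ty1` (g5), TYPER ASK T-μk of the UTD lead (`bsd-wall-utd-p2` g12,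
memo `Cruxes/TwinSplitIMCAtThreeMult/MEMBER-INCLUSION-AT3-g12.md` §2/§4): "generalise
`Hsieh2014.thmB_exists_isHsiehLFunction_coeff_norm_eq_one_unrPeriod_anyLevel` from weight `2` to weight `k` against
`IsBDPLFunctionWt…`" — consumer: the member-tower stub `stub_pubMuMembers` of crux `stmt-BirchSwinnertonDyer-27172`
(`μ(L_p(g_m)) = 0` for the Hida members `g_m` of `f_E`, weight `k_m ≡ 2 (mod p − 1)`, level prime to `p`,
`ρ̄_{g_m} ≅ ρ̄_{E,p}`). HONEST FRAMING: two definitions with bodies + proved API + ONE named fact (`def … : Prop`,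
nothing asserted, no `_holds`; net debt +1) + proved corollaries. BSD is not advanced by this file; nothing about the
crux, the route, the `R₀`-rationality of any element, or any case of BSD is proved or claimed.

## Source (e-print locators `[p. … l. …]` = held text `paper:arxiv-1112.1580`, re-read 2026-08-28; print =
## Doc. Math. 19 (2014) 709–767, Thm. B p. 712/713 = Thm. 6.2 p. 757, erratum E-G131-1 of the Thm. A file)

The SETTING of Thm. 1/2 is for `π` of ANY cohomological weight: "We assume that `π` has infinity type
`κ = Σ_σ k_σ σ ∈ ℤ_{>0}[Σ]` and `λ` has infinity type `(κ/2, −κ/2)`. In other words, `π_σ` is a discrete series or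
limit of discrete series of weight `k_σ` with unitary central character at every archimedean place `σ`" [p. 3 l. 20];
"Let `p` be an odd rational prime … (ord) `Σ` is `p`-ordinary" [p. 3 ll. 24–27]; "Hypothesis 1. The local root
number `ε*(π_{𝒦_v}, λ_v) = +1` for each `v ∣ 𝔫⁻`" [p. 3 l. 22]; "`𝔑` the prime-to-`p` conductor of `π_𝒦 ⊗ λ`"
[p. 4 l. 1]. Thm. 1 [p. 4 ll. 13–18]: "In addition to (ord) and Hypothesis 1, we further assume that (sf) `𝔫⁻` is
square-free. Then there exists an element `𝒫_Σ(π, λ) ∈ Λ` such that for every `φ̂ ∈ 𝔛` of weight `(m, −m)`, we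
have `φ̂(𝒫_Σ(π,λ)²)/Ω_p^{2(κ+2m)} = [𝒪_𝒦^× : 𝒪_𝓕^×]² · Γ_Σ(κ+m)Γ_Σ(m+1)/((Im δ)^{κ+2m}(4π)^{κ+2m+1·Σ}) ·
E_{Σ_p}(π, λφ) · L(½, π_𝒦 ⊗ λφ)/Ω_𝒦^{2(κ+2m)} · φ(ℭ) C(π, λ)`". The `μ`-invariant [p. 4 ll. 24–27]:
"`μ⁻_{π,λ,Σ} = inf{r ∈ ℚ_{≥0} ∣ p^{−r}𝒫_Σ(π,λ) ≢ 0 (mod 𝔪_pΛ)}`". Thm. 2 [p. 4 ll. 29–37]: "With the assumptions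
in Theorem 1, suppose further that (1) `p` is unramified in `𝓕`, (2) the residual Galois representation
`ρ̄_p(π_𝒦) := ρ_p(π)|_{G_𝒦} (mod 𝔪_p)` is absolutely irreducible, (3) `p ∤ ∏_{v∣𝔠_λ⁻} #(Δ_{λ,v})`. Then
`μ⁻_{π,λ,Σ} = 0`." [p. 4 l. 39]: "In particular, suppose that `(𝔫, 𝒟_{𝒦/𝓕}) = 1` and `ρ_p(π)` is residually
irreducible. Then we always have `μ⁻_{π,λ} = 0` whenever `λ` has split conductor over `𝓕` (`𝔠_λ⁻ = (1)`)." Proof: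
Thm. 6.1 [p. 25 l. 23] and Thm. 6.2 [p. 25 l. 54] with Remark 6.4 [p. 26 l. 61] — NO hypothesis on the weight
beyond the setting enters §6 (the toric forms `𝐟*_{λ,u}` are defined for every `π` of the setting).

## What is typed (`𝓕 = ℚ`, `κ = k = 2r` EVEN, `π = π_g`, `n := r + m ≥ r = k/2`), clause by clause

Exactly the weight-`2` transcription of the companion files with the weight put back where Hsieh prints it:
* (S3-k) `π = π_g`, `g ∈ S_k(Γ₀(M))` a NEWFORM (`IsNewform0 g`) of EVEN weight `k ≥ 2` (binders `2 ≤ k`, `Even k`;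
  Hsieh allows every `κ ∈ ℤ_{>0}`, the tree's `HasInfinityType` takes INTEGER types, so `λ` of type `(k/2, −k/2)`
  needs `k` even — the printed range of Castella–Hsieh 2018 (`2r`) and of the consumer (`k_m ≡ 2 (mod p − 1)`));
  trivial central character (`Γ₀(M)`), so `λ|_{𝔸_ℚ^×} = ω⁻¹ = 1` (typed verbatim, as at weight `2`);
* (S5-k) `p ∤ M` (`π_p` an unramified principal series): then (E1) is the clean unramified evaluation
  `ε(½, π_p ⊗ χ_𝔭, ψ_p) = 1`, `L(½, π_p ⊗ χ_𝔭)^{−2} = (1 − a_p(g) p^{−k/2} x + p^{−1} x²)²` (unitary Satake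
  parameters `α′β′ = 1`, `α′ + β′ = a_p(g) p^{−(k−1)/2}`; `x = χ_𝔭(ϖ_𝔭)` = `heckeValueExtZero χ 𝔭`) — LITERALLY the
  polynomial of the tree's `bdpInterpolationValueWt` (Castella–Hsieh: `e_𝔭(f, χ) = (1 − a_p(f) p^{−r} χ_𝔭̄(p) +
  χ_𝔭̄(p²) p^{−1})²`, the same evaluation of Hsieh's `E_{Σ_p}` in print: Math. Ann. 370 §3.3); the Steinberg branch
  `p ∥ M` of the weight-`2` files is NOT typed at weight `k` (there `a_p(g) = ±p^{(k−2)/2}` is not a unit, so the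
  weight-`2` absorption (W3) of `−a_p` into the unit constant `C` does not go through verbatim) — the definition
  `hsiehInterpolationValueWt` keeps the weight-`2` shape of that branch (factor `p^{n·[p∣M]}`, `e_p = 0`) ONLY so that
  it reduces to `hsiehInterpolationValue` at `k = 2` for every level (`hsiehInterpolationValueWt_two`); at `p ∣ M`,
  `k > 2` it is not a printed object and the named fact carries `¬ p ∣ M`;
* (S8-k) the range: `χ = λφ` of `Σ`-type `(k/2 + m, −k/2 − m) = (n, −n)`, `n ≥ k/2` — the range `k / 2 ≤ n` of
  `IsBDPLFunctionWt` —, unramified at every finite place, indexed by `χ` with its avatar through `Γ⁻` (as (S8));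
  the central value `L(½, π_𝒦 ⊗ χ)` (unitary normalisation) is `L(g/K, χ, k/2)` = `rankinSelbergValueHeckeWt g χ (k/2)`
  (Castella 2020 Rem. 2.12: "central critical values");
* the display: with `κ + 2m = 2n`, `Γ_Σ(κ+m)Γ_Σ(m+1) = Γ(n + k/2)Γ(n − k/2 + 1)`, `(Im δ)^{κ+2m}(4π)^{κ+2m+1} =
  A^{2n} 4^{2n+1} π^{2n+1}` (`4⁻¹` into `C`, as (W3)), `Ω_p^{2(κ+2m)} = Ω_p^{4n}`, `Ω_𝒦^{2(κ+2m)} = Ω_K^{4n}`,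
  `[𝒪_K^×:ℤ^×]²`, `C(π,λ)` and the `λ`-part of `φ(ℭ)` into `C`, the `χ`-part of `φ(ℭ)` removed by `[g]⁻¹` (W2)–(W3)
  verbatim: `hsiehInterpolationValueWt = Γ(n − k/2 + 1)Γ(n + k/2) · (1 − a_p p^{−k/2} x + e_p x²)² · L(g/K, χ, k/2) ·
  C / (A^{2n} 4^{2n} π^{2n+1} Ω_K^{4n})` `= C/(A^{2n}4^{2n}) · bdpInterpolationValueWt` at `p ∤ M`
  (`hsiehInterpolationValueWt_eq_mul_bdpInterpolationValueWt`);
* (S1), (S2) (CM type `{σ̄₀}`, `Σ_p = {𝔭̄}`, the prime `𝔭` INDUCED by `ι`), (S4) (`𝔫⁻ = 1`: every `ℓ ∣ M` splits —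
  `SatisfiesHeegnerHypothesis M K` — so Hypothesis 1 and (sf) are vacuous), (S6)–(S7) (`λ` unramified outside `p`,
  with an avatar through `Γ⁻`; then `𝔠_λ⁻ = (1)` and hypothesis (3) of Thm. 2 is VACUOUS [p. 4 l. 39]), (W1)–(W4),
  (E2): verbatim; hypothesis (1) of Thm. 2 is vacuous (`𝓕 = ℚ`);
* HYPOTHESIS (2) of Thm. 2 — "`ρ̄_p(π_g)|_{G_K}` absolutely irreducible", the residual representation taken w.r.t.
  the SAME `ι : ℂ ≅ ℂ_p` as the interpolation formula — is typed in the SPECIAL CASE the consumer lives in: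
  `ρ̄_{g,ι} ≅ ρ̄_{E,p}` for an elliptic curve `E/ℚ` whose mod-`p` representation restricted to `G_K` is absolutely
  irreducible. Binders: `W : WeierstrassCurve ℚ`, `f` with `IsNewformOf W f` (so `a_ℓ(f) = a_ℓ(E)`), the CONGRUENCE
  `‖ι⁻¹(a_ℓ(g) − a_ℓ(f))‖_p < 1` for every prime `ℓ ∤ pMN` (`a_ℓ = cuspCoeff · ℓ ∈ ℂ`, transported by `ι⁻¹`, i.e.
  `a_ℓ(g) ≡ a_ℓ(E)` modulo the prime `𝔓_ι` of `ℚ̄` induced by `ι`), and — as in the weight-`2` companion — "every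
  framed mod-`p` representation of `E/K` (`(W.baseChange K).IsTorsionGaloisRep p ρ`) is
  `FramedRep.IsAbsolutelyIrreducible`". WHY THIS IMPLIES (2): `tr ρ̄_{g,ι}(Frob_ℓ) = a_ℓ(g) mod 𝔓_ι` and
  `tr ρ̄_{E,p}(Frob_ℓ) = a_ℓ(E) mod p` agree for all `ℓ ∤ pMN`, hence (Chebotarev, continuity) the two semisimple
  `𝔽̄_p`-representations of `G_ℚ` have equal traces, hence (Brauer–Nesbitt in dimension `2 < p`, `p` odd) isomorphic
  semisimplifications; `ρ̄_{E,p}|_{G_K}` absolutely irreducible forces `ρ̄_{E,p}` absolutely irreducible, so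
  `ρ̄_{g,ι}^{ss} ≅ ρ̄_{E,p} ⊗ 𝔽̄_p` is irreducible, `ρ̄_{g,ι} ≅ ρ̄_{E,p} ⊗ 𝔽̄_p`, and `ρ̄_{g,ι}|_{G_K}` is absolutely
  irreducible. A SPECIAL CASE of the printed hypothesis (weaker than print, never stronger);
  `-- TODO(general form): hypothesis (2) for an arbitrary newform g (needs the tree's residual representation of`
  `-- g w.r.t. ι, cf. NewformGaloisRepModL.lean for weight one), odd weights / 𝓕 ≠ ℚ / 𝔠_λ⁻ ≠ (1), p ∣ M, and the`
  `-- converse Thm. 6.2.`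
* CONCLUSION: the any-level companion's shape — a frame `(A, Ω_K, C, Ω_p, Q)` with `0 < A`, `Ω_K ≠ 0`,
  `‖ι⁻¹ C‖_p = 1`, `Ω_p ∈ 𝒲^× = R₀^×` (its printed home [p. 23 l. 64]: `(Ω_∞, Ω_p) ∈ (ℂ^×)^Σ × (Z̄_p^×)^Σ`, the
  Katz–Hida–Tilouine periods; Castella–Hsieh 2018 §2.5 `(Ω_K, Ω_p) ∈ ℂ^× × 𝒲^×`), `IsHsiehLFunctionWt ι 𝔭 κ γ g A Ω_K C
  Ω_p Q` (`Q = [g]⁻¹ · Tw_{λ̂⁻¹}(𝒫_Σ(π_g,λ)²) ∈ 𝒪_{ℂ_p}⟦T⟧`) AND `∃ n, ‖[Tⁿ]Q‖ = 1` (`Q ≢ 0 (mod 𝔪_{ℂ_p})`, the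
  consequence of `μ⁻ = 0` exactly as explained in the weight-`2` companion: Thm. 6.1 makes the infimum attained,
  `Λ/𝔪_pΛ` is a domain, `Tw` and `[g]⁻¹` preserve non-vanishing mod `𝔪_p`).
WEAKER than print on its range, never stronger.

## Against the BDP frame (the ask), PROVED not asserted

`IsHsiehLFunctionWt.exists_isBDPLFunctionWtSigmaInt`: a Hsieh frame `(A, Ω_K, C, Ω_p, Q)` with `0 < A`,
`‖ι⁻¹C‖ = 1` yields `Q′ := ι⁻¹(C)⁻¹ · Q ∈ 𝒪_{ℂ_p}⟦T⟧` with `IsBDPLFunctionWtSigmaInt ι 𝔭 κ γ g ∅ (c · Ω_K) Ω_p Q′`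
for the explicit real `c = (16A²/p^{[p∣M]})^{1/4} > 0` (the archimedean monomial `(16 A²)^n` and the factor
`p^{n[p∣M]}` go into the complex period, `Ω_K^{4n} ↦ (cΩ_K)^{4n}`; the unit `ι⁻¹C` into the element) and
`‖[Tʲ]Q′‖ = ‖[Tʲ]Q‖` for every `j` — so the `μ = 0` clause transfers. Hence the consumer-shaped corollary
`Hsieh2014.exists_isBDPLFunctionWtSigmaInt_coeff_norm_eq_one_of_thmBWt`: under the fact's hypotheses there is a
Σ = ∅ weight-`k` BDP-normalised `𝒪_{ℂ_p}`-frame `Q′` of `g` with `R₀`-unit `p`-adic period and a coefficient of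
norm one. NOT asserted: `Q′ ∈ R₀⟦T⟧` / `∈ 𝒪_m⟦T⟧` (Hsieh's receptacle is `Z̄_p⟦Γ⁻⟧`; the rationality of the
member's `L_p(g_m)` is the consumer's own input), nor any comparison with a GIVEN `IsBDPLFunctionWt` frame `L` of
`g` (rigidity across periods).

## Contents

* §1 `hsiehInterpolationValueWt` + `hsiehInterpolationValueWt_eq_mul_bdpInterpolationValueWt`, `hsiehInterpolationValueWt_two`.
* §2 `IsHsiehLFunctionWt` + `hasValueAt`, `eq_of_hasValueAt`, `isHsiehLFunctionWt_two_iff`.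
* §3 `IntSeries.HasValueAt.const_mul`, `bdpInterpolationValueWt_mul_period`,
  `IsHsiehLFunctionWt.exists_isBDPLFunctionWtSigmaInt` (the bridge, proved).
* §4 (namespace `…Hsieh2014`) the named fact `thmB_exists_isHsiehLFunctionWt_coeff_norm_eq_one_unrPeriod` and the
  proved corollaries `exists_isHsiehLFunction_coeff_norm_eq_one_of_thmBWt` (weight `2`, `p ∤ N`: the companion's
  shape) and `exists_isBDPLFunctionWtSigmaInt_coeff_norm_eq_one_of_thmBWt`.

## References

* [Hsieh2014] M.-L. Hsieh, *Special values of anticyclotomic Rankin–Selberg L-functions*, Doc. Math. 19 (2014)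
  709–767: Thm. B (p. 712) = arXiv:1112.1580 Thm. 2 [p. 4 ll. 29–37], setting [p. 3 l. 20, ll. 22–28], Thm. 1
  [p. 4 ll. 13–18], `μ⁻` [p. 4 ll. 24–27], p. 4 l. 39, Thm. 6.1–6.2 [p. 25 ll. 23, 54], Remark 6.4 [p. 26 l. 61],
  periods [p. 23 l. 64].
* [CastellaHsieh2018] F. Castella, M.-L. Hsieh, Math. Ann. 370 (2018), §2.5 (periods in `𝒲^×`), §3.3 Prop. 3.8
  (the weight-`2r` multiplier `e_𝔭`).
* [Castella2020JIMJ] F. Castella, J. Inst. Math. Jussieu 19 (2020), Rem. 2.12 (central values at weight `k`).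
* [Bump1997] D. Bump, *Automorphic forms and representations*, Prop. 3.1.9 (`ε = 1` for unramified data).
* [CurtisReiner1962] C. W. Curtis, I. Reiner, *Representation theory of finite groups and associative algebras*,
  (30.16) (Brauer–Nesbitt); [DeligneSerreASENS1974] Lemme 3.2 (traces on Frobenii determine the semisimplification).
* Tree: `Hsieh2014/AnticyclotomicMuInvariant.lean`, `Hsieh2014/AnticyclotomicMuInvariantAnyLevel.lean`,
  `AnticyclotomicRankinSelbergPAdicLFunction.lean`, `BDPAnticyclotomicPAdicLFunctionHigherWeight.lean`,
  `BDPAnticyclotomicPAdicLFunctionSigmaInt.lean`, `UnrIntegersUnits.lean`.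
-/

noncomputable section

open scoped MatrixGroups ModularForm Topology NumberField
open CongruenceSubgroup NumberField IsDedekindDomain Field
open Literature.NumberTheory.GaloisRepresentations
open Literature.NumberTheory.EllipticCurves.ModularForms
open Literature.NumberTheory.Automorphic

namespace Literature.NumberTheory.EllipticCurves

universe u

/-! ### §1. Hsieh's weight-`k` display -/

section DisplayWt

variable {K : Type u} [Field K] [NumberField K] {M N : ℕ} {k : ℤ}

/-- **Hsieh's weight-`k` interpolation value** (Thm. 1 [p. 4 ll. 13–18] at `𝓕 = ℚ`, `κ = k = 2r`, CM type `{σ̄₀}`,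
`χ = λφ` of `Σ`-type `(n, −n)`, `n = r + m`; module docstring): with `x = χ_𝔭(ϖ_𝔭)` (`heckeValueExtZero χ 𝔭`),
`e_p = p⁻¹` if `p ∤ M` and `0` if `p ∣ M`,
`Γ(n − k/2 + 1)Γ(n + k/2) · p^{n·[p ∣ M]} · (1 − a_p(g) p^{−k/2} x + e_p x²)² · L(g/K, χ, k/2) · C /
(A^{2n} · 4^{2n} · π^{2n+1} · Ω_K^{4n})` — VERBATIM the weight-`2` `hsiehInterpolationValue` with the weight
restored in the three printed places (`Γ_Σ(κ+m)Γ_Σ(m+1)`, the multiplier `E_{Σ_p}` = Castella–Hsieh's `e_𝔭` with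
`p^{−r}`, the central point `s = k/2`); `k/2` is integer division. At `p ∣ M`, `k > 2` this is NOT a printed
object (docstring (S5-k)); it is kept so that `hsiehInterpolationValueWt_two` holds at every level.
[cite: Hsieh2014, Thm. A p. 712 (Doc. Math. 19) = Thm. 1 (arXiv:1112.1580 p. 4 ll. 13–18), setting p. 3 l. 20]
[cite: CastellaHsieh2018, §3.3 Prop. 3.8 (the multiplier `e_𝔭` at weight `2r`)] -/
def hsiehInterpolationValueWt (p : ℕ) (g : CuspForm (Gamma0 M) k) (𝔭 : HeightOneSpectrum (𝓞 K))
    (χ : HeckeCharacter K) (n : ℕ) (A : ℝ) (ΩK C : ℂ) : ℂ :=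
  let x : ℂ := heckeValueExtZero χ 𝔭
  let ep : ℂ := if p ∣ M then 0 else ((p : ℂ))⁻¹
  let ρp : ℂ := if p ∣ M then (p : ℂ) ^ n else 1
  let r : ℤ := k / 2
  Complex.Gamma ((n : ℂ) - (r : ℂ) + 1) * Complex.Gamma ((n : ℂ) + (r : ℂ)) * ρp *
      (1 - cuspCoeff g p * ((p : ℂ) ^ r)⁻¹ * x + ep * x ^ 2) ^ 2 *
        rankinSelbergValueHeckeWt g χ (r : ℂ) * C /
    ((A : ℂ) ^ (2 * n) * (4 : ℂ) ^ (2 * n) * (Real.pi : ℂ) ^ (2 * n + 1) * ΩK ^ (4 * n))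

/-- **Hsieh's weight-`k` display is Castella's weight-`k` display times `C · p^{n[p∣M]} / (A^{2n} 4^{2n})`**
(same Gamma factors, same multiplier polynomial, same central value, same `Ω_K^{4n}`; the weight-`k` twin of
`hsiehInterpolationValue_eq_mul_bdpInterpolationValue`).
[cite: Hsieh2014, Thm. A p. 712 = Thm. 1 (arXiv:1112.1580 p. 4)] [cite: CastellaHsieh2018, §3.3 Prop. 3.8] -/
theorem hsiehInterpolationValueWt_eq_mul_bdpInterpolationValueWt (p : ℕ) (g : CuspForm (Gamma0 M) k)
    (𝔭 : HeightOneSpectrum (𝓞 K)) (χ : HeckeCharacter K) (n : ℕ) (A : ℝ) (ΩK C : ℂ) :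
    hsiehInterpolationValueWt p g 𝔭 χ n A ΩK C =
      C * (if p ∣ M then (p : ℂ) ^ n else 1) / ((A : ℂ) ^ (2 * n) * (4 : ℂ) ^ (2 * n)) *
        bdpInterpolationValueWt p g 𝔭 χ n ΩK := by
  unfold hsiehInterpolationValueWt bdpInterpolationValueWt
  simp only
  split_ifs <;> ring

/-- **At weight `2` Hsieh's weight-`k` display is the weight-`2` display `hsiehInterpolationValue`** (`k/2 = 1`:
`Γ(n − 1 + 1)Γ(n + 1) = Γ(n)Γ(n+1)`, `p^{−1}`, `L(f/K, χ, 1)`), at every level.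
[cite: Hsieh2014, Thm. A p. 712 = Thm. 1 (arXiv:1112.1580 p. 4)] -/
theorem hsiehInterpolationValueWt_two (p : ℕ) (f : CuspForm (Gamma0 N) 2) (𝔭 : HeightOneSpectrum (𝓞 K))
    (χ : HeckeCharacter K) (n : ℕ) (A : ℝ) (ΩK C : ℂ) :
    hsiehInterpolationValueWt p f 𝔭 χ n A ΩK C = hsiehInterpolationValue p f 𝔭 χ n A ΩK C := by
  have hr : ((2 : ℤ) / 2) = 1 := by decide
  simp only [hsiehInterpolationValueWt, hsiehInterpolationValue, hr, Int.cast_one, sub_add_cancel, zpow_one,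
    rankinSelbergValueHeckeWt_two]

/-- Scaling the complex period: `bdpInterpolationValueWt … (c · Ω_K) = bdpInterpolationValueWt … Ω_K / c^{4n}`
(the display is homogeneous of degree `−4n` in `Ω_K`). [cite: CastellaHsieh2018, §3.3 Prop. 3.8] -/
theorem bdpInterpolationValueWt_mul_period (p : ℕ) (g : CuspForm (Gamma0 M) k) (𝔭 : HeightOneSpectrum (𝓞 K))
    (φ : HeckeCharacter K) (n : ℕ) (c ΩK : ℂ) :
    bdpInterpolationValueWt p g 𝔭 φ n (c * ΩK) = bdpInterpolationValueWt p g 𝔭 φ n ΩK / c ^ (4 * n) := by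
  unfold bdpInterpolationValueWt
  simp only
  rw [mul_pow]
  ring

end DisplayWt

/-! ### §2. The frame `IsHsiehLFunctionWt` -/

section FrameWt

variable {K : Type u} [Field K] [NumberField K] {M N : ℕ} {k : ℤ}
variable {p : ℕ} [Fact p.Prime]

/-- **Hsieh's interpolation property in the twisted variable, weight `k`** (Thm. 1 at `𝓕 = ℚ`, `κ = k`, CM type
`{σ̄₀}`; the weight-`k` twin of `IsHsiehLFunction`): `Q ∈ 𝒪_{ℂ_p}⟦T⟧` (`1 + T ↔ γ`) satisfies, for every Hecke
character `χ` of `K` UNRAMIFIED at all finite places, of `Σ`-infinity type `(n, −n)` with `n ≥ k/2` (tree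
`HasInfinityType (n) (−n)`, integer division `k/2`; the range of `IsBDPLFunctionWt`), and every `p`-adic avatar `r`
of `χ` factoring through `Γ⁻`, that the value of `Q` at `T = r(γ) − 1` is
`ι⁻¹(hsiehInterpolationValueWt p g 𝔭 χ n A Ω_K C) · Ω_p^{4n}`. Parameters as in `IsHsiehLFunction` (`ι`, the prime
`𝔭` induced by `ι`, `κ`, `γ`, the form `g` — meant: a newform of even weight `k ≥ 2` and level `M` prime to `p`
—, `A = Im σ̄₀(δ)`, `Ω_K`, the `φ`-independent constant `C`, `Ω_p`). A characterising PREDICATE (plain definition;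
nothing asserted). At `k = 2`: `isHsiehLFunctionWt_two_iff`.
[cite: Hsieh2014, Thm. A p. 712 (Doc. Math. 19) = Thm. 1 (arXiv:1112.1580 p. 4 ll. 13–18), setting p. 3 l. 20] -/
def IsHsiehLFunctionWt (ι : PadicAlgCl p ≃+* ℂ) (𝔭 : HeightOneSpectrum (𝓞 K)) (κ : ZpExtension K p)
    (γ : absoluteGaloisGroup K) (g : CuspForm (Gamma0 M) k) (A : ℝ) (ΩK C : ℂ) (Ωp : ℂ_[p])
    (Q : PowerSeries (PadicComplexInt p)) : Prop :=
  ∀ (χ : HeckeCharacter K) (n : ℕ), k / 2 ≤ (n : ℤ) → (∀ v : HeightOneSpectrum (𝓞 K), χ.IsUnramifiedAt v) →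
    χ.HasInfinityType (fun _ ↦ (n : ℤ)) (fun _ ↦ -(n : ℤ)) →
    ∀ r : FramedGaloisRep K (PadicAlgCl p) 1, IsPAdicAvatarOf ι χ r → FactorsThroughZp κ r →
      IntSeries.HasValueAt Q (avatarValueAt r γ - 1)
        (((ι.symm (hsiehInterpolationValueWt p g 𝔭 χ n A ΩK C) : PadicAlgCl p) : ℂ_[p]) * Ωp ^ (4 * n))

variable {ι : PadicAlgCl p ≃+* ℂ} {𝔭 : HeightOneSpectrum (𝓞 K)} {κ : ZpExtension K p}
  {γ : absoluteGaloisGroup K} {g : CuspForm (Gamma0 M) k} {A : ℝ} {ΩK C : ℂ} {Ωp : ℂ_[p]}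
  {Q : PowerSeries (PadicComplexInt p)}

/-- Unfolding `IsHsiehLFunctionWt` at one character of the typed range.
[cite: Hsieh2014, Thm. A p. 712 = Thm. 1 (arXiv:1112.1580 p. 4)] -/
theorem IsHsiehLFunctionWt.hasValueAt (hQ : IsHsiehLFunctionWt ι 𝔭 κ γ g A ΩK C Ωp Q)
    {χ : HeckeCharacter K} {n : ℕ} (hn : k / 2 ≤ (n : ℤ))
    (hunr : ∀ v : HeightOneSpectrum (𝓞 K), χ.IsUnramifiedAt v)
    (hinf : χ.HasInfinityType (fun _ ↦ (n : ℤ)) (fun _ ↦ -(n : ℤ)))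
    {r : FramedGaloisRep K (PadicAlgCl p) 1} (hr : IsPAdicAvatarOf ι χ r) (hκ : FactorsThroughZp κ r) :
    IntSeries.HasValueAt Q (avatarValueAt r γ - 1)
      (((ι.symm (hsiehInterpolationValueWt p g 𝔭 χ n A ΩK C) : PadicAlgCl p) : ℂ_[p]) * Ωp ^ (4 * n)) :=
  hQ χ n hn hunr hinf r hr hκ

/-- The prescribed value at a character of the typed range is unique.
[cite: Hsieh2014, Thm. A p. 712 = Thm. 1 (arXiv:1112.1580 p. 4)] -/
theorem IsHsiehLFunctionWt.eq_of_hasValueAt (hQ : IsHsiehLFunctionWt ι 𝔭 κ γ g A ΩK C Ωp Q)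
    {χ : HeckeCharacter K} {n : ℕ} (hn : k / 2 ≤ (n : ℤ))
    (hunr : ∀ v : HeightOneSpectrum (𝓞 K), χ.IsUnramifiedAt v)
    (hinf : χ.HasInfinityType (fun _ ↦ (n : ℤ)) (fun _ ↦ -(n : ℤ)))
    {r : FramedGaloisRep K (PadicAlgCl p) 1} (hr : IsPAdicAvatarOf ι χ r) (hκ : FactorsThroughZp κ r)
    {v : ℂ_[p]} (hv : IntSeries.HasValueAt Q (avatarValueAt r γ - 1) v) :
    v = ((ι.symm (hsiehInterpolationValueWt p g 𝔭 χ n A ΩK C) : PadicAlgCl p) : ℂ_[p]) * Ωp ^ (4 * n) :=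
  hv.unique (hQ.hasValueAt hn hunr hinf hr hκ)

/-- **At weight `2` the frame is the companion's frame**: for `f ∈ S₂(Γ₀(N))`,
`IsHsiehLFunctionWt ι 𝔭 κ γ f A Ω_K C Ω_p Q ↔ IsHsiehLFunction ι 𝔭 κ γ f A Ω_K C Ω_p Q` (range `2/2 ≤ n ↔ 0 < n`,
value `hsiehInterpolationValueWt_two`). [cite: Hsieh2014, Thm. A p. 712 = Thm. 1 (arXiv:1112.1580 p. 4)] -/
theorem isHsiehLFunctionWt_two_iff {f : CuspForm (Gamma0 N) 2} :
    IsHsiehLFunctionWt ι 𝔭 κ γ f A ΩK C Ωp Q ↔ IsHsiehLFunction ι 𝔭 κ γ f A ΩK C Ωp Q := by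
  have hr : ((2 : ℤ) / 2) = 1 := by decide
  have hiff : ∀ n : ℕ, ((2 : ℤ) / 2 ≤ (n : ℤ)) ↔ 0 < n := fun n ↦ by rw [hr]; omega
  simp only [IsHsiehLFunctionWt, IsHsiehLFunction, hiff, hsiehInterpolationValueWt_two]

end FrameWt

/-! ### §3. Against the BDP frame: a Hsieh frame is a Σ = ∅ BDP-normalised `𝒪_{ℂ_p}`-frame up to a unit
constant and a rescaled complex period (PROVED) -/

section Bridge

variable {K : Type u} [Field K] [NumberField K] {M : ℕ} {k : ℤ}
variable {p : ℕ} [Fact p.Prime]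

/-- `x ∈ 𝒪_{ℂ_p} ↔ ‖x‖ ≤ 1` (local copy of the tree's `mem_padicComplexInt_iff`, Rubin1991 file, to keep imports
small). [folklore] -/
private theorem mem_padicComplexInt_iff' {x : ℂ_[p]} : x ∈ PadicComplexInt p ↔ ‖x‖ ≤ 1 := by
  rw [PadicComplexInt, Valuation.mem_valuationSubring_iff, PadicComplex.norm_eq_norm, Valuation.norm_def]
  simp

/-- Values of a constant multiple: if `Q` has value `v` at `x` then `u · Q` has value `u · v`
(`[Tᵏ](u Q) = u [Tᵏ]Q`). [cite: Hsieh2014, Thm. A p. 712 = Thm. 1 (arXiv:1112.1580 p. 4)] -/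
theorem IntSeries.HasValueAt.const_mul {Q : PowerSeries (PadicComplexInt p)} {x v : ℂ_[p]}
    (h : IntSeries.HasValueAt Q x v) (u : PadicComplexInt p) :
    IntSeries.HasValueAt (PowerSeries.C u * Q) x ((u : ℂ_[p]) * v) := by
  unfold IntSeries.HasValueAt at h ⊢
  have h' := h.mul_left (u : ℂ_[p])
  refine h'.congr_fun fun j ↦ ?_
  simp only [PowerSeries.coeff_C_mul, MulMemClass.coe_mul, mul_assoc]

variable {ι : PadicAlgCl p ≃+* ℂ} {𝔭 : HeightOneSpectrum (𝓞 K)} {κ : ZpExtension K p}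
  {γ : absoluteGaloisGroup K} {g : CuspForm (Gamma0 M) k} {A : ℝ} {ΩK C : ℂ} {Ωp : ℂ_[p]}
  {Q : PowerSeries (PadicComplexInt p)}

/-- **A Hsieh weight-`k` frame is a Σ = ∅ weight-`k` BDP-normalised `𝒪_{ℂ_p}`-frame, up to the unit `ι⁻¹C` on the
element and the real constant `c = (16A²/p^{[p∣M]})^{1/4}` on the complex period, with the SAME coefficient norms**:
from `IsHsiehLFunctionWt ι 𝔭 κ γ g A Ω_K C Ω_p Q`, `0 < A`, `‖ι⁻¹C‖ = 1` one gets `Q′ = ι⁻¹(C⁻¹) · Q` with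
`IsBDPLFunctionWtSigmaInt ι 𝔭 κ γ g ∅ (c Ω_K) Ω_p Q′` and `‖[Tʲ]Q′‖ = ‖[Tʲ]Q‖` (so "a coefficient of norm one"
transfers). Bookkeeping between the tree's two normalisations (`hsiehInterpolationValueWt_eq_mul_bdpInterpolationValueWt`,
`bdpInterpolationValueWt_mul_period`); nothing printed is added.
[cite: Hsieh2014, Thm. A p. 712 = Thm. 1 (arXiv:1112.1580 p. 4)] [cite: CastellaHsieh2018, §3.3 Prop. 3.8] -/
theorem IsHsiehLFunctionWt.exists_isBDPLFunctionWtSigmaInt (hQ : IsHsiehLFunctionWt ι 𝔭 κ γ g A ΩK C Ωp Q)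
    (hA : 0 < A) (hC : ‖((ι.symm C : PadicAlgCl p) : ℂ_[p])‖ = 1) :
    ∃ (c : ℝ) (Q' : PowerSeries (PadicComplexInt p)), 0 < c ∧
      IsBDPLFunctionWtSigmaInt ι 𝔭 κ γ g ∅ ((c : ℂ) * ΩK) Ωp Q' ∧
      ∀ j : ℕ, ‖((PowerSeries.coeff j Q' : PadicComplexInt p) : ℂ_[p])‖ =
        ‖((PowerSeries.coeff j Q : PadicComplexInt p) : ℂ_[p])‖ := by
  -- the real constant
  set ρ : ℝ := if p ∣ M then (p : ℝ) else 1 with hρ_def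
  have hρ : 0 < ρ := by
    rw [hρ_def]; split_ifs
    · exact_mod_cast (Fact.out : p.Prime).pos
    · exact one_pos
  set B : ℝ := 16 * A ^ 2 / ρ with hB_def
  have hB : 0 < B := by rw [hB_def]; positivity
  set c : ℝ := B ^ ((1 : ℝ) / 4) with hc_def
  have hc : 0 < c := Real.rpow_pos_of_pos hB _
  have hc4 : ∀ n : ℕ, (c : ℂ) ^ (4 * n) = ((B ^ n : ℝ) : ℂ) := by
    intro n
    have h1 : c ^ (4 * n) = B ^ n := by
      rw [hc_def, ← Real.rpow_natCast, ← Real.rpow_mul hB.le]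
      have : (1 : ℝ) / 4 * ((4 * n : ℕ) : ℝ) = (n : ℝ) := by push_cast; ring
      rw [this, Real.rpow_natCast]
    exact_mod_cast congrArg (fun t : ℝ ↦ (t : ℂ)) h1
  -- the unit constant
  have hC0 : C ≠ 0 := by
    rintro rfl
    simp at hC
  have hC' : ‖(ι.symm C : PadicAlgCl p)‖ = 1 := by rwa [PadicComplex.norm_extends] at hC
  have hCinv_norm : ‖((ι.symm C⁻¹ : PadicAlgCl p) : ℂ_[p])‖ = 1 := by
    rw [PadicComplex.norm_extends, map_inv₀, norm_inv, hC', inv_one]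
  set u : PadicComplexInt p :=
    ⟨((ι.symm C⁻¹ : PadicAlgCl p) : ℂ_[p]), mem_padicComplexInt_iff'.2 hCinv_norm.le⟩ with hu_def
  have hu : ((u : PadicComplexInt p) : ℂ_[p]) = ((ι.symm C⁻¹ : PadicAlgCl p) : ℂ_[p]) := rfl
  -- the complex bookkeeping
  have hBρ : B * ρ = 16 * A ^ 2 := by rw [hB_def]; field_simp
  have hAn : ∀ n : ℕ, (A : ℂ) ^ (2 * n) * (4 : ℂ) ^ (2 * n) = ((B ^ n : ℝ) : ℂ) * ((ρ ^ n : ℝ) : ℂ) := by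
    intro n
    have h1 : ((B ^ n : ℝ) : ℂ) * ((ρ ^ n : ℝ) : ℂ) = (((B * ρ) ^ n : ℝ) : ℂ) := by push_cast; ring
    rw [h1, hBρ]
    push_cast
    rw [show (16 : ℂ) * (A : ℂ) ^ 2 = ((4 : ℂ) * A) ^ 2 by ring, ← pow_mul, mul_pow]
    ring
  have hρn : ∀ n : ℕ, (if p ∣ M then (p : ℂ) ^ n else 1) = ((ρ ^ n : ℝ) : ℂ) := by
    intro n
    rw [hρ_def]
    split_ifs <;> simp
  have key : ∀ (n : ℕ) (φ : HeckeCharacter K),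
      (((ι.symm (bdpInterpolationValueWt p g 𝔭 φ n ΩK / ((B ^ n : ℝ) : ℂ))) : PadicAlgCl p) : ℂ_[p]) =
        ((ι.symm C⁻¹ : PadicAlgCl p) : ℂ_[p]) *
          (((ι.symm (C * (if p ∣ M then (p : ℂ) ^ n else 1) / ((A : ℂ) ^ (2 * n) * (4 : ℂ) ^ (2 * n)) *
            bdpInterpolationValueWt p g 𝔭 φ n ΩK)) : PadicAlgCl p) : ℂ_[p]) := by
    intro n φ
    rw [← UniformSpace.Completion.coe_mul, ← map_mul]
    congr 2
    rw [hρn n, hAn n]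
    have hBn : ((B ^ n : ℝ) : ℂ) ≠ 0 := by exact_mod_cast (pow_pos hB n).ne'
    have hρn0 : ((ρ ^ n : ℝ) : ℂ) ≠ 0 := by exact_mod_cast (pow_pos hρ n).ne'
    field_simp
  refine ⟨c, PowerSeries.C u * Q, hc, ?_, ?_⟩
  · intro φ n hn hunr hinf r hr hκr
    have hv := (hQ φ n hn hunr hinf r hr hκr).const_mul u
    rw [bdpInterpolationValueWtSigma_empty]
    convert hv using 1
    rw [hu, hsiehInterpolationValueWt_eq_mul_bdpInterpolationValueWt, bdpInterpolationValueWt_mul_period,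
      hc4 n, key n φ, mul_assoc]
  · intro j
    simp only [PowerSeries.coeff_C_mul, MulMemClass.coe_mul, norm_mul, hu, hCinv_norm, one_mul]

end Bridge

end Literature.NumberTheory.EllipticCurves

/-! ### §4. The named fact (weight `k`) and its corollaries -/

namespace Literature.NumberTheory.EllipticCurves.Hsieh2014

open Literature.NumberTheory.EllipticCurves

/-- **Hsieh, Doc. Math. 19 (2014), Theorem B (p. 712) = Thm. 2 [arXiv:1112.1580 p. 4 ll. 29–37] = Thm. 6.2, IN
WEIGHT `k`** — the anticyclotomic `μ`-invariant of `𝒫_Σ(π_g, λ)` VANISHES, for `π = π_g`, `g ∈ S_k(Γ₀(M))` a newform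
of EVEN weight `k ≥ 2` (Hsieh's setting: "`π` has infinity type `κ ∈ ℤ_{>0}[Σ]` and `λ` has infinity type
`(κ/2, −κ/2)`" [p. 3 l. 20]) and level `M` prime to the ODD prime `p` [p. 3 l. 24; p. 4 l. 1], in the frame
`IsHsiehLFunctionWt` with the `p`-adic CM period in its printed home `𝒲^× = R₀^×` [p. 23 l. 64]. Binders = those of
the weight-`2` any-level fact VERBATIM with: `f ↦ g` of weight `k` (`2 ≤ k`, `Even k`, `IsNewform0 g`, `¬ p ∣ M`),
`λ` of type `(k/2, −k/2)`, the Heegner hypothesis for `M` (Hypothesis 1 and (sf) vacuous), and hypothesis (2)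
"`ρ̄_p(π_g)|_{G_K}` absolutely irreducible" in the special case `ρ̄_{g,ι} ≅ ρ̄_{E,p}`: an elliptic `W/ℚ` with its
newform `f` (`IsNewformOf W f`), the congruence `‖ι⁻¹(a_ℓ(g) − a_ℓ(f))‖_p < 1` at every prime `ℓ ∤ pMN`, and
"every framed mod-`p` representation of `E/K` is absolutely irreducible" (⟹ (2) by Chebotarev + Brauer–Nesbitt,
module docstring); hypotheses (1), (3) vacuous (`𝓕 = ℚ`; `𝔠_λ⁻ = (1)` [p. 4 l. 39]). Conclusion: a frame
`(A, Ω_K, C, Ω_p, Q)` with `0 < A`, `Ω_K ≠ 0`, `‖ι⁻¹C‖ = 1`, `Ω_p ∈ R₀^×`, `IsHsiehLFunctionWt ι 𝔭 κ γ g A Ω_K C Ω_p Q`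
AND `∃ n, ‖[Tⁿ]Q‖ = 1` (`Q ≢ 0 (mod 𝔪_{ℂ_p})`, the consequence of `μ⁻_{π_g,λ,Σ} = 0` via Thm. 6.1). WEAKER than
print on its range, never stronger. Named fact; nothing asserted; no `_holds`.
[cite: Hsieh2014, Thm. B p. 712 (Doc. Math. 19) = Thm. 2 (arXiv:1112.1580 p. 4 ll. 29–37), setting p. 3 l. 20 and ll. 22–28, Thm. 1 p. 4 ll. 13–18, p. 4 l. 39, Thm. 6.1–6.2 (p. 25 ll. 23, 54), Remark 6.4 (p. 26 l. 61), p. 23 l. 64]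
[cite: CastellaHsieh2018, §2.5 (periods in `𝒲^×`) and §3.3 Prop. 3.8 (the weight-`2r` multiplier)] -/
def thmB_exists_isHsiehLFunctionWt_coeff_norm_eq_one_unrPeriod : Prop :=
  ∀ {p : ℕ} [Fact p.Prime] (ι : PadicAlgCl p ≃+* ℂ) (K : Type) [Field K] [NumberField K]
    (𝔭 : HeightOneSpectrum (𝓞 K)) (κ : ZpExtension K p) (γ : absoluteGaloisGroup K)
    {M : ℕ} [NeZero M] {k : ℤ} (g : CuspForm (Gamma0 M) k)
    {N : ℕ} [NeZero N] (W : WeierstrassCurve ℚ) [W.IsElliptic] (f : CuspForm (Gamma0 N) 2)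
    (lam : HeckeCharacter K) (rlam : FramedGaloisRep K (PadicAlgCl p) 1),
    p ≠ 2 → 2 ≤ k → Even k → IsNewform0 g → ¬ p ∣ M →
    IsNewformOf W f →
    (∀ ℓ : ℕ, ℓ.Prime → ¬ ℓ ∣ p * M * N →
      ‖((ι.symm (cuspCoeff g ℓ - cuspCoeff f ℓ) : PadicAlgCl p) : ℂ_[p])‖ < 1) →
    IsImaginaryQuadratic K → ((Ideal.span {(p : ℤ)}).primesOver (𝓞 K)).ncard = 2 →
    ((p : ℕ) : 𝓞 K) ∈ 𝔭.asIdeal →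
    (∀ (w : InfinitePlace K) (x : 𝓞 K), x ∈ 𝔭.asIdeal ↔ ‖ι.symm (w.embedding (x : K))‖ < 1) →
    SatisfiesHeegnerHypothesis M K →
    (∀ ρ : ModPGaloisRep K (ZMod p) 2, (W.baseChange K).IsTorsionGaloisRep p ρ →
      FramedRep.IsAbsolutelyIrreducible ρ) →
    lam.IsUnitary → lam.HasInfinityType (fun _ ↦ k / 2) (fun _ ↦ -(k / 2)) →
    (∀ x : ideleGroup ℚ, lam (AdeleRing.ideleBaseChange ℚ K x) = 1) →
    (∀ v : HeightOneSpectrum (𝓞 K), ((p : ℕ) : 𝓞 K) ∉ v.asIdeal → lam.IsUnramifiedAt v) →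
    IsPAdicAvatarOf ι lam rlam → FactorsThroughZp κ rlam →
    κ.IsAnticyclotomic → κ.IsTopGenerator γ →
    ∃ (A : ℝ) (ΩK C : ℂ) (Ωp : (unrIntegers p)ˣ) (Q : PowerSeries (PadicComplexInt p)),
      0 < A ∧ ΩK ≠ 0 ∧ ‖((ι.symm C : PadicAlgCl p) : ℂ_[p])‖ = 1 ∧
        IsHsiehLFunctionWt ι 𝔭 κ γ g A ΩK C ((Ωp : unrIntegers p) : ℂ_[p]) Q ∧
        ∃ n : ℕ, ‖((PowerSeries.coeff n Q : PadicComplexInt p) : ℂ_[p])‖ = 1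

/-! #### Corollaries (kernel bookkeeping; nothing asserted) -/

/-- **At weight `2` the weight-`k` fact gives the companion's Thm. B shape for `p ∤ N`**: take `g = f = f_E`
(`k = 2`, the congruence binder is `‖0‖ < 1`; `IsNewformOf W f` gives `IsNewform0 f`), read the frame through
`isHsiehLFunctionWt_two_iff` and the `R₀`-unit period in norm one (`unrIntegers.isUnit_iff_norm_eq_one`).
[cite: Hsieh2014, Thm. B p. 712 (Doc. Math. 19) = Thm. 2 (arXiv:1112.1580 p. 4)] -/
theorem exists_isHsiehLFunction_coeff_norm_eq_one_of_thmBWt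
    (h : thmB_exists_isHsiehLFunctionWt_coeff_norm_eq_one_unrPeriod)
    {p : ℕ} [Fact p.Prime] (ι : PadicAlgCl p ≃+* ℂ) (K : Type) [Field K] [NumberField K]
    (𝔭 : HeightOneSpectrum (𝓞 K)) (κ : ZpExtension K p) (γ : absoluteGaloisGroup K)
    {N : ℕ} [NeZero N] (W : WeierstrassCurve ℚ) [W.IsElliptic] (f : CuspForm (Gamma0 N) 2)
    (lam : HeckeCharacter K) (rlam : FramedGaloisRep K (PadicAlgCl p) 1)
    (hp : p ≠ 2) (hf : IsNewformOf W f) (hN : ¬ p ∣ N) (hK : IsImaginaryQuadratic K)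
    (hsplit : ((Ideal.span {(p : ℤ)}).primesOver (𝓞 K)).ncard = 2)
    (h𝔭 : ((p : ℕ) : 𝓞 K) ∈ 𝔭.asIdeal)
    (hι : ∀ (w : InfinitePlace K) (x : 𝓞 K), x ∈ 𝔭.asIdeal ↔ ‖ι.symm (w.embedding (x : K))‖ < 1)
    (hHeeg : SatisfiesHeegnerHypothesis N K)
    (habs : ∀ ρ : ModPGaloisRep K (ZMod p) 2, (W.baseChange K).IsTorsionGaloisRep p ρ →
      FramedRep.IsAbsolutelyIrreducible ρ)
    (hu : lam.IsUnitary) (hinf : lam.HasInfinityType (fun _ ↦ (1 : ℤ)) (fun _ ↦ (-1 : ℤ)))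
    (htriv : ∀ x : ideleGroup ℚ, lam (AdeleRing.ideleBaseChange ℚ K x) = 1)
    (hunr : ∀ v : HeightOneSpectrum (𝓞 K), ((p : ℕ) : 𝓞 K) ∉ v.asIdeal → lam.IsUnramifiedAt v)
    (hav : IsPAdicAvatarOf ι lam rlam) (hfac : FactorsThroughZp κ rlam)
    (hκ : κ.IsAnticyclotomic) (hγ : κ.IsTopGenerator γ) :
    ∃ (A : ℝ) (ΩK C : ℂ) (Ωp : ℂ_[p]) (Q : PowerSeries (PadicComplexInt p)),
      0 < A ∧ ΩK ≠ 0 ∧ ‖((ι.symm C : PadicAlgCl p) : ℂ_[p])‖ = 1 ∧ ‖Ωp‖ = 1 ∧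
        IsHsiehLFunction ι 𝔭 κ γ f A ΩK C Ωp Q ∧
        ∃ n : ℕ, ‖((PowerSeries.coeff n Q : PadicComplexInt p) : ℂ_[p])‖ = 1 := by
  have hcong : ∀ ℓ : ℕ, ℓ.Prime → ¬ ℓ ∣ p * N * N →
      ‖((ι.symm (cuspCoeff f ℓ - cuspCoeff f ℓ) : PadicAlgCl p) : ℂ_[p])‖ < 1 := by
    intro ℓ _ _
    simp
  have h2 : (2 : ℤ) / 2 = 1 := by decide
  have hinf' : lam.HasInfinityType (fun _ ↦ (2 : ℤ) / 2) (fun _ ↦ -((2 : ℤ) / 2)) := by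
    rw [h2]; exact hinf
  obtain ⟨A, ΩK, C, Ωp, Q, hA, hΩK, hC, hQ, hn⟩ :=
    h ι K 𝔭 κ γ f W f lam rlam hp le_rfl even_two hf.1 hN hf hcong hK hsplit h𝔭 hι hHeeg habs hu
      hinf' htriv hunr hav hfac hκ hγ
  exact ⟨A, ΩK, C, ((Ωp : unrIntegers p) : ℂ_[p]), Q, hA, hΩK, hC,
    (unrIntegers.isUnit_iff_norm_eq_one _).mp Ωp.isUnit, isHsiehLFunctionWt_two_iff.mp hQ, hn⟩

/-- **The consumer-shaped corollary (against the BDP frame): under the fact's hypotheses there is a Σ = ∅ weight-`k`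
BDP-normalised `𝒪_{ℂ_p}`-frame of `g` — `IsBDPLFunctionWtSigmaInt ι 𝔭 κ γ g ∅ Ω_K′ Ω_p Q′` with `Ω_K′ ≠ 0`,
`Ω_p ∈ R₀^×` — having a coefficient of norm one (`μ(Q′) = 0`).** From the fact through
`IsHsiehLFunctionWt.exists_isBDPLFunctionWtSigmaInt`. NOT asserted: `Q′ ∈ R₀⟦T⟧`, nor `Q′ = ` a given frame of `g`.
[cite: Hsieh2014, Thm. B p. 712 (Doc. Math. 19) = Thm. 2 (arXiv:1112.1580 p. 4)] [cite: CastellaHsieh2018, §3.3 Prop. 3.8] -/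
theorem exists_isBDPLFunctionWtSigmaInt_coeff_norm_eq_one_of_thmBWt
    (h : thmB_exists_isHsiehLFunctionWt_coeff_norm_eq_one_unrPeriod)
    {p : ℕ} [Fact p.Prime] (ι : PadicAlgCl p ≃+* ℂ) (K : Type) [Field K] [NumberField K]
    (𝔭 : HeightOneSpectrum (𝓞 K)) (κ : ZpExtension K p) (γ : absoluteGaloisGroup K)
    {M : ℕ} [NeZero M] {k : ℤ} (g : CuspForm (Gamma0 M) k)
    {N : ℕ} [NeZero N] (W : WeierstrassCurve ℚ) [W.IsElliptic] (f : CuspForm (Gamma0 N) 2)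
    (lam : HeckeCharacter K) (rlam : FramedGaloisRep K (PadicAlgCl p) 1)
    (hp : p ≠ 2) (hk : 2 ≤ k) (hke : Even k) (hg : IsNewform0 g) (hM : ¬ p ∣ M) (hf : IsNewformOf W f)
    (hcong : ∀ ℓ : ℕ, ℓ.Prime → ¬ ℓ ∣ p * M * N →
      ‖((ι.symm (cuspCoeff g ℓ - cuspCoeff f ℓ) : PadicAlgCl p) : ℂ_[p])‖ < 1)
    (hK : IsImaginaryQuadratic K) (hsplit : ((Ideal.span {(p : ℤ)}).primesOver (𝓞 K)).ncard = 2)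
    (h𝔭 : ((p : ℕ) : 𝓞 K) ∈ 𝔭.asIdeal)
    (hι : ∀ (w : InfinitePlace K) (x : 𝓞 K), x ∈ 𝔭.asIdeal ↔ ‖ι.symm (w.embedding (x : K))‖ < 1)
    (hHeeg : SatisfiesHeegnerHypothesis M K)
    (habs : ∀ ρ : ModPGaloisRep K (ZMod p) 2, (W.baseChange K).IsTorsionGaloisRep p ρ →
      FramedRep.IsAbsolutelyIrreducible ρ)
    (hu : lam.IsUnitary) (hinf : lam.HasInfinityType (fun _ ↦ k / 2) (fun _ ↦ -(k / 2)))
    (htriv : ∀ x : ideleGroup ℚ, lam (AdeleRing.ideleBaseChange ℚ K x) = 1)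
    (hunr : ∀ v : HeightOneSpectrum (𝓞 K), ((p : ℕ) : 𝓞 K) ∉ v.asIdeal → lam.IsUnramifiedAt v)
    (hav : IsPAdicAvatarOf ι lam rlam) (hfac : FactorsThroughZp κ rlam)
    (hκ : κ.IsAnticyclotomic) (hγ : κ.IsTopGenerator γ) :
    ∃ (ΩK' : ℂ) (Ωp : (unrIntegers p)ˣ) (Q' : PowerSeries (PadicComplexInt p)),
      ΩK' ≠ 0 ∧ IsBDPLFunctionWtSigmaInt ι 𝔭 κ γ g ∅ ΩK' ((Ωp : unrIntegers p) : ℂ_[p]) Q' ∧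
        ∃ n : ℕ, ‖((PowerSeries.coeff n Q' : PadicComplexInt p) : ℂ_[p])‖ = 1 := by
  obtain ⟨A, ΩK, C, Ωp, Q, hA, hΩK, hC, hQ, n, hn⟩ :=
    h ι K 𝔭 κ γ g W f lam rlam hp hk hke hg hM hf hcong hK hsplit h𝔭 hι hHeeg habs hu hinf htriv hunr hav hfac hκ hγ
  obtain ⟨c, Q', hc, hQ', hnorm⟩ := hQ.exists_isBDPLFunctionWtSigmaInt hA hC
  refine ⟨(c : ℂ) * ΩK, Ωp, Q', mul_ne_zero (by exact_mod_cast hc.ne') hΩK, hQ', n, ?_⟩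
  rw [hnorm n, hn]

end Literature.NumberTheory.EllipticCurves.Hsieh2014

end
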